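import Literature.Computability.Complexity.CodeFPArith
import Mathlib.NumberTheory.Zsqrtd.GaussianInt
import HarnessLib

/-!
# Typed polynomial time on codes: padded list arithmetic, positional updates, Gaussian integers

Trunk toolkit above `CodeFP.lean` / `CodeFPArith.lean` (typed `FP` combinators between encoded
types). The combinators added here are the ones a program manipulating coefficient vectors and
matrices over small rings needs and the two base files do not provide:

* structure plumbing: `transparent` (a map that is the identity on codes), `xorBit`;
* lists: `replicateOf` (`(a, 1ⁿ) ↦ [a, …, a]`), `unSubLen` (`1ⁿ ↦ 1^{n − |l|}`), `padTo`
  (`l ++ replicate (n − |l|) d`), `zipWithPad` (entrywise operation after padding both lists to the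
  longer length — the shape of coefficientwise sums of polynomials / vectors of different lengths),
  `setAt` (`List.set`), `mapIdx` (`List.mapIdx`, through `rawEnum`), `rangeOf` (`[0, …, n)` from a
  binary `n` capped by a unary budget);
* Gaussian integers as integer pairs `(re, im)` coded by `pairE intE intE` (`zgE`): `zgAdd`,
  `zgMul` and their `CodeFP` facts, with the bridge `zgOf : GaussianInt → ℤ × ℤ`
  (`zgOf_add`, `zgOf_mul`, `zgOf_injective`).

All statements are `CodeFP` facts (equations between mathematical maps, computed on codes by a
polynomial-time string function); no machine is written.

## References

* S. Arora, B. Barak, *Computational Complexity: A Modern Approach*, CUP 2009, §1.3 (closure of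
  polynomial time under composition and polynomially bounded loops).
-/

namespace Literature.Computability.Complexity.CodeFP

open _root_.Computability

variable {α β γ σ : Type} {eα : α → List Bool} {eβ : β → List Bool} {eγ : γ → List Bool}
  {eσ : σ → List Bool}

/-! ### Plumbing -/

/-- A map that is the identity on codes (a change of type presentation: structure ↔ tuple).
[folklore] -/
theorem transparent {g : α → β} (h : ∀ a, eβ (g a) = eα a) : CodeFP eα eβ g :=
  ⟨_root_.id, PolyTimeComputable.id _, fun a => (h a).symm⟩

/-- Exclusive or of two computed bits. [folklore] -/
theorem xor {p q : α → Bool} (hp : CodeFP eα bitE p) (hq : CodeFP eα bitE q) :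
    CodeFP eα bitE (fun a => (p a ^^ q a)) :=
  ((hp.and hq.not).or (hp.not.and hq)).congr fun a => by cases p a <;> cases q a <;> rfl

/-- Exclusive or on a pair of bits. [folklore] -/
theorem xorBit : CodeFP (pairE bitE bitE) bitE (fun p => (p.1 ^^ p.2)) := xor (fst _ _) (snd _ _)

/-! ### Replication, padding, padded `zipWith` -/

/-- `(a, 1ⁿ) ↦ replicate n a`. [folklore] -/
theorem replicateOf (eα : α → List Bool) :
    CodeFP (pairE eα unE) (rawE eα) (fun p => List.replicate p.2 p.1) :=
  ((map (σ := α) (α := Unit) (eσ := eα) (eα := unitE) (g := fun q => q.1) (fst _ _)).comp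
    ((fst _ _).pair (replicateUnit.comp (snd _ _)))).congr fun p => by
      simp [List.map_replicate]

/-- `(1ⁿ, l) ↦ 1^{n − |l|}` (unary). [folklore] -/
theorem unSubLen (eα : α → List Bool) :
    CodeFP (pairE unE (rawE eα)) unE (fun p => p.1 - p.2.length) :=
  (unOfNatMin.comp ((fst _ _).pair (natSub.comp ((natOfUn.comp (fst _ _)).pair
    ((natLength eα).comp (snd _ _)))))).congr fun p => by
      simp only [id]
      exact min_eq_left (Nat.sub_le _ _)

/-- **Padding** `(d, 1ⁿ, l) ↦ l ++ replicate (n − |l|) d`. [folklore] -/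
theorem padTo (eα : α → List Bool) :
    CodeFP (pairE eα (pairE unE (rawE eα))) (rawE eα)
      (fun p => p.2.2 ++ List.replicate (p.2.1 - p.2.2.length) p.1) :=
  (rawAppend eα).comp ((snd _ _).snd'.pair ((replicateOf eα).comp ((fst _ _).pair
    ((unSubLen eα).comp (snd _ _)))))

/-- `zipWith` after padding both lists to the longer length with the given defaults (the context
carries the two defaults). [folklore] -/
def zipWithPad (g : α → β → γ) (dα : α) (dβ : β) (u : List α) (v : List β) : List γ :=
  List.zipWith g (u ++ List.replicate (max u.length v.length - u.length) dα)
    (v ++ List.replicate (max u.length v.length - v.length) dβ)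

/-- The length of `zipWithPad` is the longer length. [folklore] -/
theorem length_zipWithPad (g : α → β → γ) (dα : α) (dβ : β) (u : List α) (v : List β) :
    (zipWithPad g dα dβ u v).length = max u.length v.length := by
  unfold zipWithPad
  rw [List.length_zipWith, List.length_append, List.length_append, List.length_replicate,
    List.length_replicate]
  omega

/-- Entries of `zipWithPad`. [folklore] -/
theorem getD_zipWithPad (g : α → β → γ) (dα : α) (dβ : β) (u : List α) (v : List β) (j : ℕ) (dγ : γ)
    (hj : j < max u.length v.length) :
    (zipWithPad g dα dβ u v).getD j dγ = g (u.getD j dα) (v.getD j dβ) := by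
  unfold zipWithPad
  have hlu : (u ++ List.replicate (max u.length v.length - u.length) dα).length = max u.length v.length := by
    rw [List.length_append, List.length_replicate]; omega
  have hlv : (v ++ List.replicate (max u.length v.length - v.length) dβ).length = max u.length v.length := by
    rw [List.length_append, List.length_replicate]; omega
  rw [List.getD_eq_getElem _ _ (by rw [List.length_zipWith, hlu, hlv, min_self]; exact hj), List.getElem_zipWith]
  congr 1
  · by_cases hu : j < u.length
    · rw [List.getElem_append_left hu, List.getD_eq_getElem _ _ hu]
    · rw [List.getElem_append_right (Nat.not_lt.1 hu), List.getElem_replicate,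
        List.getD_eq_default _ _ (Nat.not_lt.1 hu)]
  · by_cases hv : j < v.length
    · rw [List.getElem_append_left hv, List.getD_eq_getElem _ _ hv]
    · rw [List.getElem_append_right (Nat.not_lt.1 hv), List.getElem_replicate,
        List.getD_eq_default _ _ (Nat.not_lt.1 hv)]

/-- The longer of two lengths, in unary. [folklore] -/
theorem unMaxLen (eα : α → List Bool) (eβ : β → List Bool) :
    CodeFP (pairE (rawE eα) (rawE eβ)) unE (fun p => max p.1.length p.2.length) := by
  have h1 : CodeFP (pairE (rawE eα) (rawE eβ)) unE (fun p => p.1.length) := (ulength eα).comp (fst _ _)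
  have h2 : CodeFP (pairE (rawE eα) (rawE eβ)) unE (fun p => p.2.length) := (ulength eβ).comp (snd _ _)
  have hle : CodeFP (pairE (rawE eα) (rawE eβ)) bitE (fun p => decide (p.1.length ≤ p.2.length)) :=
    natLe.comp ((natOfUn.comp h1).pair (natOfUn.comp h2))
  exact (hle.ite h2 h1).congr fun p => by
    by_cases h : p.1.length ≤ p.2.length
    · rw [decide_eq_true h, if_pos rfl, max_eq_right h]
    · rw [decide_eq_false h]; simp [max_eq_left (Nat.le_of_not_le h)]

/-- **Padded `zipWith` with a context**: the two defaults are computed from the context.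
[cite: AroraBarak2009, §1.3] -/
theorem zipWithPadCtx {g : σ × α × β → γ} {dα : σ → α} {dβ : σ → β}
    (hg : CodeFP (pairE eσ (pairE eα eβ)) eγ g) (hdα : CodeFP eσ eα dα) (hdβ : CodeFP eσ eβ dβ) :
    CodeFP (pairE eσ (pairE (rawE eα) (rawE eβ))) (rawE eγ)
      (fun p => zipWithPad (fun a b => g (p.1, a, b)) (dα p.1) (dβ p.1) p.2.1 p.2.2) := by
  have hm : CodeFP (pairE eσ (pairE (rawE eα) (rawE eβ))) unE (fun p => max p.2.1.length p.2.2.length) :=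
    (unMaxLen eα eβ).comp (snd _ _)
  have hu : CodeFP (pairE eσ (pairE (rawE eα) (rawE eβ))) (rawE eα)
      (fun p => p.2.1 ++ List.replicate (max p.2.1.length p.2.2.length - p.2.1.length) (dα p.1)) :=
    (padTo eα).comp ((hdα.comp (fst _ _)).pair (hm.pair (snd _ _).fst'))
  have hv : CodeFP (pairE eσ (pairE (rawE eα) (rawE eβ))) (rawE eβ)
      (fun p => p.2.2 ++ List.replicate (max p.2.1.length p.2.2.length - p.2.2.length) (dβ p.1)) :=
    (padTo eβ).comp ((hdβ.comp (fst _ _)).pair (hm.pair (snd _ _).snd'))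
  exact ((zipWith hg).comp ((fst _ _).pair (hu.pair hv))).congr fun p => rfl

/-! ### Positional updates and indexed maps -/

/-- **`List.set`** on raw lists with a binary index: `(l, i, a) ↦ l.set i a`.
[cite: AroraBarak2009, §1.3] -/
theorem setAt (eα : α → List Bool) :
    CodeFP (pairE (rawE eα) (pairE natE eα)) (rawE eα) (fun p => p.1.set p.2.1 p.2.2) := by
  have hl : CodeFP (pairE (rawE eα) (pairE natE eα)) (rawE eα) (fun t => t.1) := fst _ _
  have hi : CodeFP (pairE (rawE eα) (pairE natE eα)) natE (fun t => t.2.1) := (snd _ _).fst'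
  have ha : CodeFP (pairE (rawE eα) (pairE natE eα)) eα (fun t => t.2.2) := (snd _ _).snd'
  have hiu : CodeFP (pairE (rawE eα) (pairE natE eα)) unE (fun t => min t.2.1 t.1.length) :=
    unOfNatMin.comp (((ulength eα).comp hl).pair hi)
  have hiu1 : CodeFP (pairE (rawE eα) (pairE natE eα)) unE (fun t => min t.2.1 t.1.length + 1) :=
    unSucc.comp hiu
  have hlt : CodeFP (pairE (rawE eα) (pairE natE eα)) bitE (fun t => decide (t.2.1 < t.1.length)) :=
    natLt.comp (hi.pair ((natLength eα).comp hl))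
  have hnew : CodeFP (pairE (rawE eα) (pairE natE eα)) (rawE eα)
      (fun t => t.1.take (min t.2.1 t.1.length) ++ t.2.2 :: t.1.drop (min t.2.1 t.1.length + 1)) :=
    (rawAppend eα).comp (((rawTakeUn eα).comp (hiu.pair hl)).pair
      ((rawCons eα).comp (ha.pair ((rawDropUn eα).comp (hiu1.pair hl)))))
  exact (hlt.ite hnew hl).congr fun t => by
    obtain ⟨l, i, a⟩ := t
    simp only
    rw [List.set_eq_take_append_cons_drop]
    by_cases h : i < l.length
    · rw [decide_eq_true h, if_pos rfl, if_pos h, min_eq_left h.le]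
    · rw [decide_eq_false h, if_neg h]; simp

/-- `mapIdx` is `map` over the indexed items. [folklore] -/
theorem mapIdx_eq_map_zip (f : ℕ → α → β) (l : List α) :
    l.mapIdx f = ((List.range l.length).zip l).map (fun q => f q.1 q.2) := by
  apply List.ext_getElem
  · simp
  · intro i h1 h2
    rw [List.getElem_mapIdx, List.getElem_map, List.getElem_zip, List.getElem_range]

/-- **`List.mapIdx` with a context.** [cite: AroraBarak2009, §1.3] -/
theorem mapIdx {g : σ × ℕ × α → β} (hg : CodeFP (pairE eσ (pairE natE eα)) eβ g) :
    CodeFP (pairE eσ (rawE eα)) (rawE eβ) (fun p => p.2.mapIdx (fun i a => g (p.1, i, a))) :=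
  ((map (σ := σ) (α := ℕ × α) (g := g) hg).comp ((fst _ _).pair ((rawEnum eα).comp (snd _ _)))).congr
    fun p => by rw [mapIdx_eq_map_zip]

/-- **`[0, …, n)` from a binary `n` and a unary budget `1ᵐ` with `n ≤ m`** (the loops of a program
whose bounds are data of polynomial size). [cite: AroraBarak2009, §1.3] -/
theorem rangeOf : CodeFP (pairE unE natE) (rawE natE) (fun p => List.range (min p.2 p.1)) :=
  urange.comp unOfNatMin

/-! ### Gaussian integers as integer pairs -/

/-- Addition of Gaussian integers presented as pairs `(re, im)`. [folklore] -/
def zgAdd (x y : ℤ × ℤ) : ℤ × ℤ := (x.1 + y.1, x.2 + y.2)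

/-- Multiplication of Gaussian integers presented as pairs:
`(a, b)·(c, d) = (ac − bd, ad + bc)`. [folklore] -/
def zgMul (x y : ℤ × ℤ) : ℤ × ℤ := (x.1 * y.1 - x.2 * y.2, x.1 * y.2 + x.2 * y.1)

/-- The pair of a Gaussian integer (Mathlib's `GaussianInt = ℤ√(-1)`). [folklore] -/
def zgOf (z : GaussianInt) : ℤ × ℤ := (z.re, z.im)

/-- `zgOf` is injective. [folklore] -/
theorem zgOf_injective : Function.Injective zgOf := fun x y h => by
  obtain ⟨h1, h2⟩ := Prod.mk.inj h
  exact Zsqrtd.ext h1 h2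

/-- `zgOf` is additive. [folklore] -/
theorem zgOf_add (x y : GaussianInt) : zgOf (x + y) = zgAdd (zgOf x) (zgOf y) := rfl

/-- `zgOf` is multiplicative. [folklore] -/
theorem zgOf_mul (x y : GaussianInt) : zgOf (x * y) = zgMul (zgOf x) (zgOf y) := by
  unfold zgOf zgMul
  simp only [Zsqrtd.re_mul, Zsqrtd.im_mul]
  exact Prod.ext (by simp; ring) (by simp)

/-- The code of an integer pair. [folklore] -/
abbrev zgE : ℤ × ℤ → List Bool := pairE intE intE

/-- `zgAdd` is typed polynomial time. [folklore] -/
theorem zgAdd_codeFP : CodeFP (pairE zgE zgE) zgE (fun p => zgAdd p.1 p.2) := by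
  have ha : CodeFP (pairE zgE zgE) intE (fun p => p.1.1) := (fst zgE zgE).fst'
  have hb : CodeFP (pairE zgE zgE) intE (fun p => p.1.2) := (fst zgE zgE).snd'
  have hc : CodeFP (pairE zgE zgE) intE (fun p => p.2.1) := (snd zgE zgE).fst'
  have hd : CodeFP (pairE zgE zgE) intE (fun p => p.2.2) := (snd zgE zgE).snd'
  have h1 : CodeFP (pairE zgE zgE) intE (fun p => p.1.1 + p.2.1) := by exact (intAdd.comp (ha.pair hc) :)
  have h2 : CodeFP (pairE zgE zgE) intE (fun p => p.1.2 + p.2.2) := by exact (intAdd.comp (hb.pair hd) :)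
  exact (h1.pair h2).congr fun p => rfl

/-- `zgMul` is typed polynomial time. [folklore] -/
theorem zgMul_codeFP : CodeFP (pairE zgE zgE) zgE (fun p => zgMul p.1 p.2) := by
  have ha : CodeFP (pairE zgE zgE) intE (fun p => p.1.1) := (fst zgE zgE).fst'
  have hb : CodeFP (pairE zgE zgE) intE (fun p => p.1.2) := (fst zgE zgE).snd'
  have hc : CodeFP (pairE zgE zgE) intE (fun p => p.2.1) := (snd zgE zgE).fst'
  have hd : CodeFP (pairE zgE zgE) intE (fun p => p.2.2) := (snd zgE zgE).snd'
  have hac : CodeFP (pairE zgE zgE) intE (fun p => p.1.1 * p.2.1) := by exact (intMul.comp (ha.pair hc) :)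
  have hbd : CodeFP (pairE zgE zgE) intE (fun p => p.1.2 * p.2.2) := by exact (intMul.comp (hb.pair hd) :)
  have had : CodeFP (pairE zgE zgE) intE (fun p => p.1.1 * p.2.2) := by exact (intMul.comp (ha.pair hd) :)
  have hbc : CodeFP (pairE zgE zgE) intE (fun p => p.1.2 * p.2.1) := by exact (intMul.comp (hb.pair hc) :)
  have h1 : CodeFP (pairE zgE zgE) intE (fun p => p.1.1 * p.2.1 - p.1.2 * p.2.2) := by
    exact (intSub.comp (hac.pair hbd) :)
  have h2 : CodeFP (pairE zgE zgE) intE (fun p => p.1.1 * p.2.2 + p.1.2 * p.2.1) := by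
    exact (intAdd.comp (had.pair hbc) :)
  exact (h1.pair h2).congr fun p => rfl

end Literature.Computability.Complexity.CodeFP
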